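import Literature.AlgebraicGeometry.Motives.Varieties
import HarnessLib

/-!
# Every proper closed subset of an embedded projective scheme lies on a hypersurface section

Family `hodge` (consumers: the restriction statements `…Theses.HeightMassDefect.SectionRestriction*`,
which ask for a hypersurface section `Z = X ∩ V₊(F)`, `F` homogeneous of degree `k ≥ 1`, containing
a given curve and different from `X`), layer `Literature/AlgebraicGeometry/Motives` (next to
`ProjectiveEmbedding`). PROVED from Mathlib's `ProjectiveSpectrum` API — no named fact.

* `exists_hypersurface_containing_of_isClosedImmersion` /
  `ProjectiveEmbedding.exists_hypersurface_containing`: for a closed `k`-immersion `ι : X ↪ ℙⁿ_k`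
  and a closed subset `C ⊊ X`, there are `d ≥ 1` and a homogeneous polynomial `F` of degree `d`
  with `C ⊆ ι⁻¹ V₊(F) ≠ X`. Proof (Hartshorne II §2, definition of `Proj S` and Lemma 2.4:
  "we define a topology on `Proj S` by taking the closed subsets to be the subsets of the form
  `V(𝔞)`", `V(𝔞) = {𝔭 ∈ Proj S | 𝔭 ⊇ 𝔞}`): pick `x ∈ X ∖ C`; `ι(C)` is closed (closed embedding), `= V₊(s)` for a
  set `s`, and `ι(x) ∉ V₊(s)`, so some `g ∈ s` has `g ∉ 𝔭 := ι(x)`; `𝔭` is a homogeneous ideal, so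
  some homogeneous component `F = g_d ∉ 𝔭`, while every component of `g` lies in each
  (homogeneous) `𝔮 ∈ V₊(s)`; `d ≠ 0` because `g₀ ∈ 𝔭` (a non-zero constant is a unit and lies in no
  `𝔮 = ι(y)`, `y ∈ C`; and if `C = ∅` we take `g` in the irrelevant ideal, `g₀ = 0`).

## References

* [Hartshorne1977] R. Hartshorne, Algebraic Geometry (Springer GTM 52, 1977), II §2: definition
  of `Proj S`, Lemma 2.4 and Prop. 2.5.
-/

noncomputable section

open AlgebraicGeometry CategoryTheory Topology

universe u

namespace Literature.AlgebraicGeometry.Motives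

attribute [local instance] MvPolynomial.gradedAlgebra

variable {k : Type u} [Field k] {n : ℕ} {X : SchemeOver k}

/-- The grading of `k[x₀, …, xₙ]` by degree (local notation; `ℙⁿ_k = Proj 𝓐`). [folklore] -/
local notation "𝓐" => MvPolynomial.homogeneousSubmodule (Fin (n + 1)) k

/-- Auxiliary: if `g ∉ 𝔭` for a point `𝔭` of `Proj k[x₀,…,xₙ]` and the degree-`0` component of `g`
lies in `𝔭`, then some homogeneous component of POSITIVE degree of `g` is not in `𝔭` (`𝔭` is a
homogeneous ideal: `g ∈ 𝔭` iff all its components are). [folklore] -/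
theorem exists_decompose_notMem (𝔭 : ProjectiveSpectrum 𝓐) {g : MvPolynomial (Fin (n + 1)) k}
    (hg : g ∉ 𝔭.asHomogeneousIdeal)
    (hg0 : (DirectSum.decompose 𝓐 g 0 : MvPolynomial (Fin (n + 1)) k) ∈ 𝔭.asHomogeneousIdeal) :
    ∃ d : ℕ, 0 < d ∧
      (DirectSum.decompose 𝓐 g d : MvPolynomial (Fin (n + 1)) k) ∉ 𝔭.asHomogeneousIdeal := by
  by_contra h
  push Not at h
  refine hg ((Ideal.IsHomogeneous.mem_iff 𝓐 𝔭.asHomogeneousIdeal.isHomogeneous).2 fun i => ?_)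
  rcases Nat.eq_zero_or_pos i with rfl | hi
  · exact hg0
  · exact h i hi

/-- Auxiliary: the degree-`0` component of an element of a point `𝔮` of `Proj k[x₀,…,xₙ]` is `0`
(it is a constant lying in the proper ideal `𝔮`, and non-zero constants are units). [folklore] -/
theorem decompose_zero_eq_zero_of_mem (𝔮 : ProjectiveSpectrum 𝓐) {g : MvPolynomial (Fin (n + 1)) k}
    (hg : g ∈ 𝔮.asHomogeneousIdeal) :
    (DirectSum.decompose 𝓐 g 0 : MvPolynomial (Fin (n + 1)) k) = 0 := by
  set g0 := (DirectSum.decompose 𝓐 g 0 : MvPolynomial (Fin (n + 1)) k) with hg0def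
  have hg0q : g0 ∈ 𝔮.asHomogeneousIdeal :=
    ((Ideal.IsHomogeneous.mem_iff 𝓐 𝔮.asHomogeneousIdeal.isHomogeneous).1 hg) 0
  have hg0hom : g0.IsHomogeneous 0 :=
    (MvPolynomial.mem_homogeneousSubmodule 0 g0).1 (SetLike.coe_mem _)
  by_contra hne
  have hdeg : g0.totalDegree = 0 := hg0hom.totalDegree hne
  have hgc : g0 = MvPolynomial.C (g0.coeff 0) := MvPolynomial.totalDegree_eq_zero_iff_eq_C.1 hdeg
  have hc : g0.coeff 0 ≠ 0 := fun h0 => hne (by rw [hgc, h0, map_zero])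
  have hunit : IsUnit g0 := by
    rw [hgc]
    exact (isUnit_iff_ne_zero.2 hc).map MvPolynomial.C
  exact 𝔮.isPrime.ne_top (Ideal.eq_top_of_isUnit_mem _ hg0q hunit)

/-- **Every proper closed subset of a closed subscheme `X ⊆ ℙⁿ_k` lies on a hypersurface section of
positive degree not containing `X`.** For a closed `k`-immersion `ι : X ⟶ ℙⁿ_k` and `C ⊆ X` closed
with `C ≠ X`, there exist `d > 0` and `F ∈ k[x₀,…,xₙ]` homogeneous of degree `d` with
`C ⊆ ι⁻¹(V₊(F))` and `ι⁻¹(V₊(F)) ≠ X` — the closed subsets of `Proj S` are cut out by homogeneous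
ideals, `V(𝔞) = {𝔭 ∈ Proj S | 𝔭 ⊇ 𝔞}` (Hartshorne II §2, definition of `Proj S` and Lemma 2.4), so a
point outside a closed set is missed by a homogeneous element of positive degree vanishing on it.
[cite: Hartshorne1977, II §2 Lemma 2.4 and Prop. 2.5] -/
theorem exists_hypersurface_containing_of_isClosedImmersion (ι : X ⟶ projectiveSpace n k)
    [IsClosedImmersion ι.left] {C : Set X.left} (hC : IsClosed C) (hCX : C ≠ Set.univ) :
    ∃ (d : ℕ) (F : MvPolynomial (Fin (n + 1)) k), 0 < d ∧ F.IsHomogeneous d ∧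
      C ⊆ ι.left.base ⁻¹' ProjectiveSpectrum.zeroLocus 𝓐 {F} ∧
      ι.left.base ⁻¹' ProjectiveSpectrum.zeroLocus 𝓐 {F} ≠ Set.univ := by
  classical
  have hf : IsClosedEmbedding ι.left.base := ι.left.isClosedEmbedding
  obtain ⟨x, hx⟩ : ∃ x, x ∉ C := by
    by_contra h
    push Not at h
    exact hCX (Set.eq_univ_of_forall h)
  -- an element `g ∉ 𝔭 = ι(x)` vanishing on `ι(C)`, with degree-0 part in `𝔭`
  obtain ⟨g, hgP, hg0, hgC⟩ : ∃ g : MvPolynomial (Fin (n + 1)) k,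
      g ∉ (ι.left.base x : ProjectiveSpectrum 𝓐).asHomogeneousIdeal ∧
      (DirectSum.decompose 𝓐 g 0 : MvPolynomial (Fin (n + 1)) k) ∈
        (ι.left.base x : ProjectiveSpectrum 𝓐).asHomogeneousIdeal ∧
      ∀ y ∈ C, g ∈ (ι.left.base y : ProjectiveSpectrum 𝓐).asHomogeneousIdeal := by
    rcases C.eq_empty_or_nonempty with rfl | ⟨y₀, hy₀⟩
    · -- `C = ∅`: take `g` in the irrelevant ideal, outside `𝔭` (a point of `Proj` is relevant)
      obtain ⟨a, ha, haP⟩ :=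
        SetLike.not_le_iff_exists.1 (ι.left.base x : ProjectiveSpectrum 𝓐).not_irrelevant_le
      refine ⟨a, haP, ?_, fun y hy => hy.elim⟩
      have ha0 : (DirectSum.decompose 𝓐 a 0 : MvPolynomial (Fin (n + 1)) k) = 0 := by
        have := (HomogeneousIdeal.mem_irrelevant_iff 𝓐 a).1 ha
        rwa [GradedRing.proj_apply] at this
      rw [ha0]
      exact zero_mem _
    · -- `C ≠ ∅`: `ι(C) = V₊(s)` and `ι(x) ∉ V₊(s)` give `g ∈ s`, `g ∉ 𝔭`
      have hC' : IsClosed (ι.left.base '' C) := hf.isClosedMap C hC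
      obtain ⟨s, hs⟩ := (ProjectiveSpectrum.isClosed_iff_zeroLocus (𝒜 := 𝓐) _).1 hC'
      have hxs : ¬ (s ⊆ (ι.left.base x : ProjectiveSpectrum 𝓐).asHomogeneousIdeal) := by
        intro hsub
        have hxmem : ι.left.base x ∈ ι.left.base '' C := by
          rw [hs]
          exact hsub
        obtain ⟨y, hy, hyx⟩ := hxmem
        exact hx (hf.injective hyx ▸ hy)
      obtain ⟨g, hgs, hgP⟩ := Set.not_subset.1 hxs
      have hgC : ∀ y ∈ C, g ∈ (ι.left.base y : ProjectiveSpectrum 𝓐).asHomogeneousIdeal :=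
        fun y hy => by
          have hy' : ι.left.base y ∈ ProjectiveSpectrum.zeroLocus 𝓐 s :=
            hs ▸ Set.mem_image_of_mem _ hy
          exact (show s ⊆ (ι.left.base y : ProjectiveSpectrum 𝓐).asHomogeneousIdeal from hy') hgs
      refine ⟨g, hgP, ?_, hgC⟩
      rw [decompose_zero_eq_zero_of_mem _ (hgC y₀ hy₀)]
      exact zero_mem _
  -- a homogeneous component of positive degree of `g` outside `𝔭`
  obtain ⟨d, hd, hFP⟩ := exists_decompose_notMem _ hgP hg0
  refine ⟨d, (DirectSum.decompose 𝓐 g d : MvPolynomial (Fin (n + 1)) k), hd,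
    (MvPolynomial.mem_homogeneousSubmodule d _).1 (SetLike.coe_mem _), fun y hy => ?_, fun huniv => ?_⟩
  · -- `C ⊆ ι⁻¹ V₊(F)`: every component of `g` lies in the homogeneous ideal `ι(y)`
    change ({(DirectSum.decompose 𝓐 g d : MvPolynomial (Fin (n + 1)) k)} : Set _) ⊆
      (ι.left.base y : ProjectiveSpectrum 𝓐).asHomogeneousIdeal
    rw [Set.singleton_subset_iff]
    exact ((Ideal.IsHomogeneous.mem_iff 𝓐
      (ι.left.base y : ProjectiveSpectrum 𝓐).asHomogeneousIdeal.isHomogeneous).1 (hgC y hy)) d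
  · -- `x ∉ ι⁻¹ V₊(F)`
    have hxF : x ∈ ι.left.base ⁻¹' ProjectiveSpectrum.zeroLocus 𝓐
        {(DirectSum.decompose 𝓐 g d : MvPolynomial (Fin (n + 1)) k)} := by
      rw [huniv]
      exact Set.mem_univ x
    have hsub : ({(DirectSum.decompose 𝓐 g d : MvPolynomial (Fin (n + 1)) k)} : Set _) ⊆
        (ι.left.base x : ProjectiveSpectrum 𝓐).asHomogeneousIdeal := hxF
    exact hFP (Set.singleton_subset_iff.1 hsub)

/-- The same for a chosen `ProjectiveEmbedding` `e` of `X`, in the exact shape of the witnesses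
`(k, F, Z)` demanded by the route items
`Summit.HodgeConjecture.HodgeConjecture.Theses.HeightMassDefect.SectionRestriction*`
(`Z = e.ι.left.base ⁻¹' V₊(F)`, `0 < k`, `F.IsHomogeneous k`, `Z ≠ univ`): every proper closed
`C ⊆ X` (e.g. a curve on a surface) lies on such a `Z`. [cite: Hartshorne1977, II §2 Lemma 2.4 and Prop. 2.5] -/
theorem ProjectiveEmbedding.exists_hypersurface_containing (e : ProjectiveEmbedding X)
    {C : Set X.left} (hC : IsClosed C) (hCX : C ≠ Set.univ) :
    ∃ (d : ℕ) (F : MvPolynomial (Fin (e.n + 1)) k), 0 < d ∧ F.IsHomogeneous d ∧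
      C ⊆ e.ι.left.base ⁻¹' (letI := MvPolynomial.gradedAlgebra (σ := Fin (e.n + 1)) (R := k);
        ProjectiveSpectrum.zeroLocus (MvPolynomial.homogeneousSubmodule (Fin (e.n + 1)) k) {F}) ∧
      e.ι.left.base ⁻¹' (letI := MvPolynomial.gradedAlgebra (σ := Fin (e.n + 1)) (R := k);
        ProjectiveSpectrum.zeroLocus (MvPolynomial.homogeneousSubmodule (Fin (e.n + 1)) k) {F}) ≠
        Set.univ :=
  exists_hypersurface_containing_of_isClosedImmersion e.ι hC hCX

end Literature.AlgebraicGeometry.Motives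

end
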